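import Mathlib
import HarnessLib
import Summits.NavierStokesRegularity.NavierStokesRegularity.Theorems.UnthreadedRigidityDoorUnthreadedRigidityHornPressureHarmonics
import Summits.NavierStokesRegularity.NavierStokesRegularity.Theorems.UnthreadedRigidityDoorUnthreadedRigidityHornPressureChannels
import Summits.NavierStokesRegularity.NavierStokesRegularity.Theorems.UnthreadedRigidityDoorUnthreadedRigidityHornPressureRadial
import Summits.NavierStokesRegularity.NavierStokesRegularity.Theorems.UnthreadedRigidityDoorUnthreadedRigidityThreadingJetsGauge

/-!
# Route `UnthreadedRigidityDoor`, item `UnthreadedRigidity` (W2, stmt-NavierStokesRegularity-27585) — LINE g10-2 «PROFILE HORN»,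
# BRIDGE PH (L-part `ThreadingJets.HornSliceIdentityTwo`), file 5: THE EXPLICIT PRESSURE IS THE SLICE PRESSURE

Prover file (W2 Lean hand ns-crc-p1 g9, by lineage; `--supports stmt-NavierStokesRegularity-27585 --as helper`).  For a horn-admissible profile
(`H(r) = h(r²)`, `h` smooth, decay clauses of `ProfileHorn.HornAdmissible`) and a quadratic form `Q`, the explicit pressure
`p* = shellPressure Q h` (`…HornPressureDefs`, p717811: `tr Q²·β₀(|z|²) + β₂(|z|²)S₂(z) + β₄(|z|²)S₄(z)`, `β_L = radCoeff L ã_L`) satisfies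

* `contDiff_shellPressure` — `p*` is smooth on `E3` (apex included: `Gin` is smooth across `s = 0`, `…HornPressureRadial`);
* ★ `laplacian_shellPressure` — `Δp*(z) = −(tr Q²·ã₀ + ã₂ S₂ + ã₄ S₄)(z)` for EVERY `z` (`laplacian_radial_mul` + the radial ODE
  `radCoeff_ode'` on `[0,∞)` — at the apex the second-order term carries the factor `|z|² = 0`), i.e. `Δp* = −σ` by `divergence_convect_sepShell`;
* `abs_shellPressure_le` — `|p*(z)| ≤ C/|z|` on `|z| ≥ 1` (`abs_radCoeff_sq_le`, `abs_quadY_le`, `abs_quartic_le`), hence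
  `tendsto_shellPressure_sub` — `p*(· − x₀) → 0` along `cocompact E3`;
* ★ `slicePressure_eq_shellPressure` — under the pressure hypotheses of `HornSliceIdentityTwo` (`p₀` smooth, `Δp₀ = −div((u₀·∇)u₀)` for
  `u₀ = sepShell H Q x₀`, `p₀ → 0` at infinity): `p₀ = p*(· − x₀)` (g8's Liouville gauge `ThreadingJets.slicePressure_eq_of_decaying`).

HONEST LABEL: potential theory of ONE explicit field, serving the L-part of ONE bridge of a RUNG line about SPECIAL (separable `l = 2`) slice
data; `UnthreadedRigidity` (27585), W2 and NS regularity remain OPEN; nothing here is a statement about Navier–Stokes dynamics.  0 kit.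
-/

-- the summit and its single sub-problem share the name (CONVENTIONS §1), as in every Theorems file
set_option linter.dupNamespace false

noncomputable section

namespace Summit.NavierStokesRegularity.NavierStokesRegularity.Theorems.UnthreadedRigidity.HornPressure

open scoped RealInnerProductSpace Topology ContDiff Laplacian
open Filter Set
open Literature.Analysis.FluidPDE
open Summit.NavierStokesRegularity.NavierStokesRegularity.Theorems.UnthreadedRigidity.ProfileHorn (E3 IsQuadForm quadY discrCubic sepShell)
open Summit.NavierStokesRegularity.NavierStokesRegularity.Theorems.UnthreadedRigidity.VirialHorn

/-! ## The explicit pressure: smoothness, Laplacian, decay, uniqueness -/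

section Pressure

variable {Q : Matrix (Fin 3) (Fin 3) ℝ} {h H : ℝ → ℝ} {C : ℝ}

/-- the radial ODE of `radCoeff` on the CLOSED half-line `[0,∞)` (at `s = 0` the second-order term carries the factor `s = 0` and the
first-order term is `(4L+6)·(−g(0)/(2(2L+3))) = −g(0)`). -/
theorem radCoeff_ode' {g : ℝ → ℝ} {K : ℝ} (hg : ContDiff ℝ ∞ g) (L : ℕ) (hK : ∀ σ : ℝ, 1 ≤ σ → |g σ| ≤ K / σ ^ (L + 2))
    {s : ℝ} (hs : 0 ≤ s) :
    4 * s * deriv (deriv (radCoeff L g)) s + (4 * L + 6) * deriv (radCoeff L g) s = -g s := by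
  rcases hs.eq_or_lt with h0 | hpos
  · subst h0
    rw [deriv_radCoeff hg L hK le_rfl, Gin_zero]
    have hL : (2 * (L : ℝ) + 3) ≠ 0 := by positivity
    field_simp
    ring
  · exact radCoeff_ode hg L hK hpos

/-- THE EXPLICIT PRESSURE IS SMOOTH on `E3` (the apex included: `Gin` is smooth across `s = 0`). -/
theorem contDiff_shellPressure (hQ : IsQuadForm Q) (hh : ContDiff ℝ ∞ h) (hH : ∀ r, 0 ≤ r → H r = h (r ^ 2))
    (hC : ∀ r, 1 ≤ r → r ^ 5 * |H r| ≤ C ∧ r ^ 6 * |deriv H r| ≤ C ∧ r ^ 7 * |deriv (deriv H) r| ≤ C) :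
    ContDiff ℝ ∞ (shellPressure Q h) := by
  have h0 := contDiff_radCoeff (contDiff_chanZero hh) 0 (fun σ hσ => abs_chanZero_le hh hH hC hσ)
  have h2 := contDiff_radCoeff (contDiff_chanTwo hh) 2 (fun σ hσ => abs_chanTwo_le hh hH hC hσ)
  have h4 := contDiff_radCoeff (contDiff_chanFour hh) 4 (fun σ hσ => abs_chanFour_le hh hH hC hσ)
  have hS2 := (isSolidHarmonic_quadY (isQuadForm_sqForm hQ.1)).contDiff
  have hS4 := contDiff_quartic Q hQ
  unfold shellPressure
  exact ((contDiff_const.mul (contDiff_radial h0)).add ((contDiff_radial h2).mul hS2)).add ((contDiff_radial h4).mul hS4)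

/-- ★ THE EXPLICIT PRESSURE SOLVES THE SLICE POISSON EQUATION (centred form):
`Δ p*(z) = −(tr Q²·ã₀(|z|²) + ã₂(|z|²) S₂(z) + ã₄(|z|²) S₄(z))` for every `z`. -/
theorem laplacian_shellPressure (hQ : IsQuadForm Q) (hh : ContDiff ℝ ∞ h) (hH : ∀ r, 0 ≤ r → H r = h (r ^ 2))
    (hC : ∀ r, 1 ≤ r → r ^ 5 * |H r| ≤ C ∧ r ^ 6 * |deriv H r| ≤ C ∧ r ^ 7 * |deriv (deriv H) r| ≤ C) (z : E3) :
    (Δ (shellPressure Q h)) z =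
      -(Matrix.trace (Q * Q) * chanZero h (‖z‖ ^ 2) + chanTwo h (‖z‖ ^ 2) * quadY (sqForm Q) z
        + chanFour h (‖z‖ ^ 2) * quartic Q z) := by
  have hQ2 := isQuadForm_sqForm hQ.1
  have hK0 : ∀ σ : ℝ, 1 ≤ σ → |chanZero h σ| ≤ (432 / 5 * C ^ 2) / σ ^ (0 + 2) := fun σ hσ => abs_chanZero_le hh hH hC hσ
  have hK2 : ∀ σ : ℝ, 1 ≤ σ → |chanTwo h σ| ≤ (576 / 7 * C ^ 2) / σ ^ (2 + 2) := fun σ hσ => abs_chanTwo_le hh hH hC hσ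
  have hK4 : ∀ σ : ℝ, 1 ≤ σ → |chanFour h σ| ≤ (152 * C ^ 2) / σ ^ (4 + 2) := fun σ hσ => abs_chanFour_le hh hH hC hσ
  have hg0 := contDiff_chanZero hh
  have hg2 := contDiff_chanTwo hh
  have hg4 := contDiff_chanFour hh
  have hb0 := contDiff_radCoeff hg0 0 hK0
  have hb2 := contDiff_radCoeff hg2 2 hK2
  have hb4 := contDiff_radCoeff hg4 4 hK4
  have hS2 := (isSolidHarmonic_quadY hQ2).contDiff
  have hS4 := contDiff_quartic Q hQ
  -- the three pieces (kept as explicit lambdas so that `laplacian_radial_mul` rewrites them verbatim)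
  have hfun : shellPressure Q h =
      (fun w : E3 => radCoeff 0 (chanZero h) (‖w‖ ^ 2) * (fun _ : E3 => Matrix.trace (Q * Q)) w)
        + (fun w : E3 => radCoeff 2 (chanTwo h) (‖w‖ ^ 2) * quadY (sqForm Q) w)
        + (fun w : E3 => radCoeff 4 (chanFour h) (‖w‖ ^ 2) * quartic Q w) := by
    funext w
    simp only [shellPressure, Pi.add_apply]
    ring
  have hc0 : ContDiff ℝ 2 (fun w : E3 => radCoeff 0 (chanZero h) (‖w‖ ^ 2) * (fun _ : E3 => Matrix.trace (Q * Q)) w) :=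
    ((contDiff_radial hb0).mul contDiff_const).of_le (by norm_cast)
  have hc2 : ContDiff ℝ 2 (fun w : E3 => radCoeff 2 (chanTwo h) (‖w‖ ^ 2) * quadY (sqForm Q) w) :=
    ((contDiff_radial hb2).mul hS2).of_le (by norm_cast)
  have hc4 : ContDiff ℝ 2 (fun w : E3 => radCoeff 4 (chanFour h) (‖w‖ ^ 2) * quartic Q w) :=
    ((contDiff_radial hb4).mul hS4).of_le (by norm_cast)
  have hL0 := laplacian_radial_mul hb0 (S := fun _ : E3 => Matrix.trace (Q * Q)) contDiff_const (L := 0)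
    (fun w => by simp) (fun w => by simp) z
  have hL2 := laplacian_radial_mul hb2 hS2 (L := 2) (fun w => by rw [fderiv_quadY_apply_self hQ2]) (laplacian_quadY hQ2) z
  have hL4 := laplacian_radial_mul hb4 hS4 (L := 4) (fun w => by rw [fderiv_quartic_apply_self hQ]) (laplacian_quartic hQ) z
  have hc02 : ContDiff ℝ 2 ((fun w : E3 => radCoeff 0 (chanZero h) (‖w‖ ^ 2) * (fun _ : E3 => Matrix.trace (Q * Q)) w)
      + (fun w : E3 => radCoeff 2 (chanTwo h) (‖w‖ ^ 2) * quadY (sqForm Q) w)) := by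
    have := hc0.add hc2
    simpa only [Pi.add_def] using this
  rw [hfun, hc02.contDiffAt.laplacian_add hc4.contDiffAt, hc0.contDiffAt.laplacian_add hc2.contDiffAt, hL0, hL2, hL4]
  have hs : 0 ≤ ‖z‖ ^ 2 := sq_nonneg _
  have e0 := radCoeff_ode' hg0 0 hK0 hs
  have e2 := radCoeff_ode' hg2 2 hK2 hs
  have e4 := radCoeff_ode' hg4 4 hK4 hs
  push_cast at e0 e2 e4 ⊢
  have e0' : (4 * ‖z‖ ^ 2 * deriv (deriv (radCoeff 0 (chanZero h))) (‖z‖ ^ 2) + (4 * 0 + 6) * deriv (radCoeff 0 (chanZero h)) (‖z‖ ^ 2))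
      = -chanZero h (‖z‖ ^ 2) := by linarith
  have e2' : (4 * ‖z‖ ^ 2 * deriv (deriv (radCoeff 2 (chanTwo h))) (‖z‖ ^ 2) + (4 * 2 + 6) * deriv (radCoeff 2 (chanTwo h)) (‖z‖ ^ 2))
      = -chanTwo h (‖z‖ ^ 2) := by linarith
  have e4' : (4 * ‖z‖ ^ 2 * deriv (deriv (radCoeff 4 (chanFour h))) (‖z‖ ^ 2) + (4 * 4 + 6) * deriv (radCoeff 4 (chanFour h)) (‖z‖ ^ 2))
      = -chanFour h (‖z‖ ^ 2) := by linarith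
  rw [e0', e2', e4']
  ring

/-- growth of a quadratic form: `|Y_M(z)| ≤ (Σ|M i j|)·|z|²`. -/
theorem abs_quadY_le (M : Matrix (Fin 3) (Fin 3) ℝ) (z : E3) :
    |quadY M z| ≤ (∑ i : Fin 3, ∑ j : Fin 3, |M i j|) * ‖z‖ ^ 2 := by
  unfold quadY
  -- `|zᵢ| ≤ |z|` (a local copy of a standard coordinate bound; kept as a `have` on purpose)
  have hcoord : ∀ i : Fin 3, |z i| ≤ ‖z‖ := by
    intro i
    have h2 : ‖z‖ ^ 2 = ∑ j : Fin 3, z j ^ 2 := by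
      rw [EuclideanSpace.norm_eq, Real.sq_sqrt (Finset.sum_nonneg fun j _ => by positivity)]
      simp [Real.norm_eq_abs, sq_abs]
    have hi : z i ^ 2 ≤ ‖z‖ ^ 2 := by
      rw [h2]
      exact Finset.single_le_sum (f := fun j => z j ^ 2) (fun j _ => sq_nonneg _) (Finset.mem_univ i)
    exact abs_le_of_sq_le_sq (by simpa using hi) (norm_nonneg z)
  have hb : ∀ i j : Fin 3, |z i * M i j * z j| ≤ |M i j| * ‖z‖ ^ 2 := by
    intro i j
    rw [abs_mul, abs_mul]
    have hi := hcoord i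
    have hj := hcoord j
    calc |z i| * |M i j| * |z j| ≤ ‖z‖ * |M i j| * ‖z‖ := by gcongr
      _ = |M i j| * ‖z‖ ^ 2 := by ring
  calc |∑ i : Fin 3, ∑ j : Fin 3, z i * M i j * z j| ≤ ∑ i : Fin 3, |∑ j : Fin 3, z i * M i j * z j| :=
        Finset.abs_sum_le_sum_abs _ _
    _ ≤ ∑ i : Fin 3, ∑ j : Fin 3, |z i * M i j * z j| := Finset.sum_le_sum fun i _ => Finset.abs_sum_le_sum_abs _ _
    _ ≤ ∑ i : Fin 3, ∑ j : Fin 3, |M i j| * ‖z‖ ^ 2 := Finset.sum_le_sum fun i _ => Finset.sum_le_sum fun j _ => hb i j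
    _ = (∑ i : Fin 3, ∑ j : Fin 3, |M i j|) * ‖z‖ ^ 2 := by
        rw [Finset.sum_mul]
        refine Finset.sum_congr rfl fun i _ => ?_
        rw [Finset.sum_mul]

/-- growth of `S₄`: `|quartic Q z| ≤ C_Q |z|⁴`. -/
theorem abs_quartic_le (Q : Matrix (Fin 3) (Fin 3) ℝ) :
    ∃ C₄ : ℝ, ∀ z : E3, |quartic Q z| ≤ C₄ * (‖z‖ ^ 2) ^ 2 := by
  set A := ∑ i : Fin 3, ∑ j : Fin 3, |Q i j| with hA
  set B := ∑ i : Fin 3, ∑ j : Fin 3, |sqForm Q i j| with hB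
  refine ⟨A ^ 2 + 4 / 7 * B + 2 / 15 * |Matrix.trace (Q * Q)|, fun z => ?_⟩
  have hY := abs_quadY_le Q z
  have hS := abs_quadY_le (sqForm Q) z
  have hs : 0 ≤ ‖z‖ ^ 2 := sq_nonneg _
  have t1 : |quadY Q z ^ 2| ≤ A ^ 2 * (‖z‖ ^ 2) ^ 2 := by
    rw [abs_pow]
    calc |quadY Q z| ^ 2 ≤ (A * ‖z‖ ^ 2) ^ 2 := pow_le_pow_left₀ (abs_nonneg _) hY 2
      _ = A ^ 2 * (‖z‖ ^ 2) ^ 2 := by ring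
  have t2 : |4 / 7 * ‖z‖ ^ 2 * quadY (sqForm Q) z| ≤ 4 / 7 * B * (‖z‖ ^ 2) ^ 2 := by
    rw [abs_mul, abs_mul, abs_of_nonneg (by norm_num : (0:ℝ) ≤ 4 / 7), abs_of_nonneg hs]
    calc 4 / 7 * ‖z‖ ^ 2 * |quadY (sqForm Q) z| ≤ 4 / 7 * ‖z‖ ^ 2 * (B * ‖z‖ ^ 2) :=
          mul_le_mul_of_nonneg_left hS (by positivity)
      _ = 4 / 7 * B * (‖z‖ ^ 2) ^ 2 := by ring
  have t3 : |2 / 15 * Matrix.trace (Q * Q) * (‖z‖ ^ 2) ^ 2| = 2 / 15 * |Matrix.trace (Q * Q)| * (‖z‖ ^ 2) ^ 2 := by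
    rw [abs_mul, abs_mul, abs_of_nonneg (by norm_num : (0:ℝ) ≤ 2 / 15), abs_of_nonneg (by positivity : (0:ℝ) ≤ (‖z‖ ^ 2) ^ 2)]
  have e1 := abs_sub (quadY Q z ^ 2 - 4 / 7 * ‖z‖ ^ 2 * quadY (sqForm Q) z) (2 / 15 * Matrix.trace (Q * Q) * (‖z‖ ^ 2) ^ 2)
  have e2 := abs_sub (quadY Q z ^ 2) (4 / 7 * ‖z‖ ^ 2 * quadY (sqForm Q) z)
  unfold quartic
  linarith

/-- weakening a decay bound on `[1,∞)`: `|x| ≤ c/r^n` with `n ≥ 1`, `r ≥ 1` gives `|x| ≤ |c|/r`. -/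
theorem abs_le_div_of_pow {x c r : ℝ} {n : ℕ} (h : |x| ≤ c / r ^ n) (hn : 1 ≤ n) (hr : 1 ≤ r) : |x| ≤ |c| / r := by
  have hr0 : 0 < r := by linarith
  calc |x| ≤ c / r ^ n := h
    _ ≤ |c| / r ^ n := div_le_div_of_nonneg_right (le_abs_self c) (by positivity)
    _ ≤ |c| / r := by
        apply div_le_div_of_nonneg_left (abs_nonneg c) hr0
        calc r = r ^ 1 := (pow_one r).symm
          _ ≤ r ^ n := pow_le_pow_right₀ hr hn

/-- ★ DECAY OF THE EXPLICIT PRESSURE: `|p*(z)| ≤ C′/|z|` for `|z| ≥ 1`. -/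
theorem abs_shellPressure_le (hh : ContDiff ℝ ∞ h) (hH : ∀ r, 0 ≤ r → H r = h (r ^ 2))
    (hC : ∀ r, 1 ≤ r → r ^ 5 * |H r| ≤ C ∧ r ^ 6 * |deriv H r| ≤ C ∧ r ^ 7 * |deriv (deriv H) r| ≤ C) :
    ∃ C' : ℝ, ∀ z : E3, 1 ≤ ‖z‖ → |shellPressure Q h z| ≤ C' / ‖z‖ := by
  obtain ⟨C0, hC0⟩ := abs_radCoeff_sq_le (contDiff_chanZero hh) 0 (fun σ hσ => abs_chanZero_le hh hH hC hσ)
  obtain ⟨C2, hC2⟩ := abs_radCoeff_sq_le (contDiff_chanTwo hh) 2 (fun σ hσ => abs_chanTwo_le hh hH hC hσ)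
  obtain ⟨C4, hC4⟩ := abs_radCoeff_sq_le (contDiff_chanFour hh) 4 (fun σ hσ => abs_chanFour_le hh hH hC hσ)
  obtain ⟨D4, hD4⟩ := abs_quartic_le Q
  set B := ∑ i : Fin 3, ∑ j : Fin 3, |sqForm Q i j| with hB
  refine ⟨|Matrix.trace (Q * Q)| * |C0| + |C2| * B + |C4| * |D4|, fun z hz => ?_⟩
  have hz0 : 0 < ‖z‖ := by linarith
  have hB0 : 0 ≤ B := Finset.sum_nonneg fun i _ => Finset.sum_nonneg fun j _ => abs_nonneg _
  -- the three coefficients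
  have h0 : |radCoeff 0 (chanZero h) (‖z‖ ^ 2)| ≤ |C0| / ‖z‖ := abs_le_div_of_pow (hC0 ‖z‖ hz) (by norm_num) hz
  have h2 : |radCoeff 2 (chanTwo h) (‖z‖ ^ 2)| ≤ |C2| / ‖z‖ ^ 5 :=
    (hC2 ‖z‖ hz).trans (div_le_div_of_nonneg_right (le_abs_self C2) (by positivity))
  have h4 : |radCoeff 4 (chanFour h) (‖z‖ ^ 2)| ≤ |C4| / ‖z‖ ^ 9 :=
    (hC4 ‖z‖ hz).trans (div_le_div_of_nonneg_right (le_abs_self C4) (by positivity))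
  -- the three angular factors
  have hS2 := abs_quadY_le (sqForm Q) z
  have hS4 : |quartic Q z| ≤ |D4| * (‖z‖ ^ 2) ^ 2 := (hD4 z).trans (mul_le_mul_of_nonneg_right (le_abs_self D4) (by positivity))
  -- the three products
  have t0 : |Matrix.trace (Q * Q) * radCoeff 0 (chanZero h) (‖z‖ ^ 2)| ≤ |Matrix.trace (Q * Q)| * |C0| / ‖z‖ := by
    rw [abs_mul, mul_div_assoc]
    exact mul_le_mul_of_nonneg_left h0 (abs_nonneg _)
  have t2 : |radCoeff 2 (chanTwo h) (‖z‖ ^ 2) * quadY (sqForm Q) z| ≤ |C2| * B / ‖z‖ := by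
    rw [abs_mul]
    calc |radCoeff 2 (chanTwo h) (‖z‖ ^ 2)| * |quadY (sqForm Q) z| ≤ |C2| / ‖z‖ ^ 5 * (B * ‖z‖ ^ 2) :=
          mul_le_mul h2 hS2 (abs_nonneg _) (by positivity)
      _ = |C2| * B / ‖z‖ ^ 3 := by field_simp
      _ ≤ |C2| * B / ‖z‖ := div_le_div_of_nonneg_left (by positivity) hz0 (le_self_pow₀ hz (by norm_num))
  have t4 : |radCoeff 4 (chanFour h) (‖z‖ ^ 2) * quartic Q z| ≤ |C4| * |D4| / ‖z‖ := by
    rw [abs_mul]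
    calc |radCoeff 4 (chanFour h) (‖z‖ ^ 2)| * |quartic Q z| ≤ |C4| / ‖z‖ ^ 9 * (|D4| * (‖z‖ ^ 2) ^ 2) :=
          mul_le_mul h4 hS4 (abs_nonneg _) (by positivity)
      _ = |C4| * |D4| / ‖z‖ ^ 5 := by field_simp
      _ ≤ |C4| * |D4| / ‖z‖ := div_le_div_of_nonneg_left (by positivity) hz0 (le_self_pow₀ hz (by norm_num))
  unfold shellPressure
  calc |Matrix.trace (Q * Q) * radCoeff 0 (chanZero h) (‖z‖ ^ 2) + radCoeff 2 (chanTwo h) (‖z‖ ^ 2) * quadY (sqForm Q) z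
        + radCoeff 4 (chanFour h) (‖z‖ ^ 2) * quartic Q z|
      ≤ |Matrix.trace (Q * Q) * radCoeff 0 (chanZero h) (‖z‖ ^ 2) + radCoeff 2 (chanTwo h) (‖z‖ ^ 2) * quadY (sqForm Q) z|
        + |radCoeff 4 (chanFour h) (‖z‖ ^ 2) * quartic Q z| := abs_add_le _ _
    _ ≤ |Matrix.trace (Q * Q) * radCoeff 0 (chanZero h) (‖z‖ ^ 2)| + |radCoeff 2 (chanTwo h) (‖z‖ ^ 2) * quadY (sqForm Q) z|
        + |radCoeff 4 (chanFour h) (‖z‖ ^ 2) * quartic Q z| := add_le_add (abs_add_le _ _) le_rfl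
    _ ≤ |Matrix.trace (Q * Q)| * |C0| / ‖z‖ + |C2| * B / ‖z‖ + |C4| * |D4| / ‖z‖ := add_le_add (add_le_add t0 t2) t4
    _ = (|Matrix.trace (Q * Q)| * |C0| + |C2| * B + |C4| * |D4|) / ‖z‖ := by ring

/-- `p* → 0` at infinity (along the cocompact filter), also after re-centring at `x₀`. -/
theorem tendsto_shellPressure_sub (hh : ContDiff ℝ ∞ h) (hH : ∀ r, 0 ≤ r → H r = h (r ^ 2))
    (hC : ∀ r, 1 ≤ r → r ^ 5 * |H r| ≤ C ∧ r ^ 6 * |deriv H r| ≤ C ∧ r ^ 7 * |deriv (deriv H) r| ≤ C) (x₀ : E3) :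
    Tendsto (fun x : E3 => shellPressure Q h (x - x₀)) (cocompact E3) (𝓝 0) := by
  obtain ⟨C', hC'⟩ := abs_shellPressure_le (Q := Q) hh hH hC
  have hnorm : Tendsto (fun x : E3 => ‖x - x₀‖) (cocompact E3) atTop := by
    have h1 : Tendsto (fun x : E3 => ‖x‖ + -‖x₀‖) (cocompact E3) atTop :=
      tendsto_atTop_add_const_right _ _ tendsto_norm_cocompact_atTop
    refine tendsto_atTop_mono (fun x => ?_) h1
    have := norm_sub_norm_le x x₀
    linarith
  have hb : Tendsto (fun x : E3 => C' / ‖x - x₀‖) (cocompact E3) (𝓝 0) := tendsto_const_nhds.div_atTop hnorm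
  refine squeeze_zero_norm' ?_ hb
  filter_upwards [hnorm.eventually (eventually_ge_atTop 1)] with x hx
  rw [Real.norm_eq_abs]
  exact hC' (x - x₀) hx

/-- ★ THE SLICE PRESSURE IS THE EXPLICIT PRESSURE: under the pressure hypotheses of `HornSliceIdentityTwo` (`p₀` smooth,
`Δp₀ = −div((u₀·∇)u₀)` for `u₀ = sepShell H Q x₀`, `p₀ → 0`), `p₀ = p*(· − x₀)`. -/
theorem slicePressure_eq_shellPressure (hQ : IsQuadForm Q) (hh : ContDiff ℝ ∞ h) (hH : ∀ r, 0 ≤ r → H r = h (r ^ 2))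
    (hC : ∀ r, 1 ≤ r → r ^ 5 * |H r| ≤ C ∧ r ^ 6 * |deriv H r| ≤ C ∧ r ^ 7 * |deriv (deriv H) r| ≤ C) (x₀ : E3)
    (hsm : ContDiff ℝ (⊤ : ℕ∞) (sepShell H Q x₀)) (hdiv : VectorCalculus.IsDivFree (sepShell H Q x₀))
    {p₀ : E3 → ℝ} (hp : ContDiff ℝ (⊤ : ℕ∞) p₀)
    (hpoi : ∀ x : E3, (Δ p₀) x = -VectorCalculus.divergence (convect (sepShell H Q x₀) (sepShell H Q x₀)) x)
    (hdec : Tendsto p₀ (cocompact E3) (𝓝 0)) :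
    p₀ = fun x : E3 => shellPressure Q h (x - x₀) := by
  refine ThreadingJets.slicePressure_eq_of_decaying hp hpoi hdec ?_ ?_ (tendsto_shellPressure_sub hh hH hC x₀)
  · exact ((contDiff_shellPressure hQ hh hH hC).of_le (by norm_cast)).comp (contDiff_id.sub contDiff_const)
  · intro x
    have hsrc := divergence_convect_sepShell hQ hh hH x₀ hsm hdiv (x - x₀)
    rw [add_sub_cancel] at hsrc
    rw [laplacian_comp_sub_const (shellPressure Q h) x₀ x, laplacian_shellPressure hQ hh hH hC (x - x₀), hsrc]

end Pressure

end Summit.NavierStokesRegularity.NavierStokesRegularity.Theorems.UnthreadedRigidity.HornPressure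

end
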